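import Summits.QuantumFields.YangMills.Theorems.BalabanUVNodesN09RegularOfLoopSmallChi29
import Literature.MathematicalPhysics.QuantumFieldTheory.Balaban1983to89.Node00.TransportOfRecordGaugeAE

/-!
# NODE N09 [B12] · ROAD B LOCALISED OVER THE COARSE DOMAIN: `D ⊆ regSetOfRecord K k ρ` (and `HasContTransportOn K k ρ D`) from data on the
# fibres over `D` ONLY — fibre-locality of the transform of record + a continuous cut-off in the coarse variable

Cell `pub-ymgap` (YM-PLAN Track A), DAG node N09 [Balaban1987RG1] (= [I]); width seat `pub-ymgap-dag-n09-w3` g6; count-neutral helper keyed to K1⁹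
`StabilityBRunRowsAtRecordR13SepCoPHV` = stmt-QuantumFields-27364 (`--kind proof --supports … --as helper`).  SUCCESSOR of this seat's g5 junction
`…N09RegularOfLoopSmallChi29.regular_of_loopSmall_chi29` (p633539; ROAD B closed by name for densities cut at the (2.9) thresholds).

WHY.  g5's theorem — like dag-n09-w2 g4's engine `regular_of_loopSmall_sharp` behind it — asks its hypotheses of the WHOLE fine configuration space:
`ρ` bounded everywhere, `ρ = 0` off a closed `K₀` lying inside the loop α-guard, `ρ` continuous at every point of `K₀` at which no non-distinguished (2.9)
threshold is active.  For the record's β-input `ρ_k = χ^{(2.9)}_k·exp[−GF_k∕g_k² + A_k]` these GLOBAL clauses meet the documented JUNK CORNER of the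
bare-choice record (K0e `Node00.critCfgOfRecord_of_not`: off the solvable set the critical configuration is `M^k(1)`, so `χ^{(2.9)}_k = 1` at fine fields
agreeing with `M^k(1)` at the non-distinguished bonds with the `b₀(c)`-variables free — outside every loop guard, and `A_k` is uncontrolled there; this
seat's g0 finding (M1)).  But the conclusion wanted at the record, `hreg : domAlt_{k+1} ⊆ regSetOfRecord K k ρ_k`, is a statement about the transform of
record ON THE FIBRES OVER `domAlt_{k+1}` only, and there the support of `ρ_k` IS inside the guard and the previous small-field domain (the p. 266–267 rider,
dag-n09-w4 g3's `hχdom` shape `supp χ_k ∩ Ū⁻¹(domAlt_{k+1}) ⊆ domAlt_k`).  THIS FILE localises road B accordingly: every hypothesis is asked only over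
`Ū⁻¹(D)`, `D` the open coarse set one wants inside the regular set, at the price of (I19) integrability of `ρ` (displayed in every N09 door anyway).

HOW.  (§1) FIBRE-LOCALITY: two integrable densities that agree on `Ū⁻¹(U)` have a.e.-equal transforms of record on `U` (this seat's g0
`Node00.transportOfRecord_mul_indicator_ae_eq`: `T(ρ·𝟙_U∘Ū) = 𝟙_U·Tρ` a.e., applied to both), hence the same `HasContTransportOn … U` and — for open `U` —
the same verdict `U ⊆ regSetOfRecord`.  (§2) THE COARSE CUT-OFF: for a continuous `φ` on coarse fields with `0 ≤ φ ≤ 1`, `φ = 0` off `D`, the density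
`U ↦ 𝟙_{K₀}(U)·ρ(U)·φ(Ū U)` satisfies g5's GLOBAL hypotheses as soon as `ρ` satisfies the LOCAL ones: it vanishes off `K₀`, is bounded by `max C₀ 0`, and is
continuous at every `U ∈ K₀` off the thresholds — three cases: `φ(Ū U) = 0` (squeeze by `max C₀ 0 · φ∘Ū`, `Ū` continuous at guard points by dag-n09-w4's
`continuousAt_avgFun_of_small`); `Ū U ∈ D`, `U ∈ interior K₀` (a product of two functions continuous at `U`); `Ū U ∈ D`, `U ∉ interior K₀` (then `ρ U = 0` by
the local support clause; squeeze by `ρ·φ∘Ū`).  (§3) Per `V₀ ∈ D` a bump `φ` with `φ = 1` on an open `U₁ ∋ V₀` (the coarse Pi space is completely regular —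
Mathlib `CompletelyRegularSpace.completely_regular`, no metric chosen); g5's `regular_of_loopSmall_chi29` for the cut-off density gives
`HasContTransportOn … U₁` for it, §1 transfers it to `ρ` (the two densities agree on `Ū⁻¹(U₁)`), so `V₀ ∈ U₁ ⊆ regSetOfRecord K k ρ`; finally K0e's
`hasContVersionOn_regSet` restricts to `D`.

WHAT IS PROVED (theorems only; 0 def, 0 instance, 0 sorry; axioms standard).
§1 `transportOfRecord_ae_eq_on_of_eqOn_preimage`, `hasContTransportOn_congr_of_eqOn_preimage`, `subset_regSetOfRecord_of_eqOn_preimage`,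
   `hasContTransportOn_of_subset_regSetOfRecord`.
§2 `cutoff_nonneg`, `cutoff_le`, `cutoff_eq_zero_of_not_mem`, `measurable_cutoff`, ★★ `continuousAt_cutoff`.
§3 ★★★ `regularOn_of_loopSmall_chi29_local` — for `k < K`, `ε₁ ≠ 0`, the loop α-guard in the standing range (`α ≤ 1∕24`, `α < δ_N`, `157·α < L^{1−d}`),
   `ν` arbitrary, `D` OPEN, `K₀` CLOSED inside the guard, `ρ ≥ 0` measurable and integrable, `ρ ≤ C₀` ON `K₀`, the LOCAL support clause
   `Ū U ∈ D → ρ U ≠ 0 → U ∈ interior K₀` and the LOCAL continuity clause `∀ U ∈ K₀, Ū U ∈ D → (no non-distinguished threshold active at U) → ContinuousAt ρ U`: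
   `D ⊆ regSetOfRecord F N K k ρ ∧ HasContTransportOn F N K k ρ D`; `continuousOn_TcanOfRecord_of_loopSmall_chi29_local`;
   ★ `domAlt_subset_regSetOfRecord_of_loopSmall_chi29_local` — the `hreg` SHAPE at `D := domAltOfRecord ν' K (k+1)`.

HONEST SCOPE ∕ FRAMING.  LOCATED, count-neutral measure theory ∕ topology BY NAME (g0 ∕ g5 of this seat, dag-n09-w2 g4's engine through g5, dag-n09-w4's
averaging continuity, K0e's `regSet` ∕ `canonVersion` faces, Mathlib's complete regularity of Pi spaces).  The LOCAL support clause (the rider), the continuity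
clause (N07's continuity of the minimiser + the `GF_k`∕`A_k` tower behind dag-n09-w2 g5's `hρc_betaInput_chi29_of_hcrit…`), (I19) stay DISPLAYED and are
asserted of NO record; NOTHING of Bałaban's asserted; `hreg`∕(F3)∕`contTOn` at the record NOT discharged; N09 NOT discharged; conjunct 1 (Lemma 4) ∕ FLAG №7
untouched; K0⁷ ∕ K1⁹ ∕ K2⁹ ∕ K3⁸ NOT closed; counts unmoved (typed 28∕28 · discharged 5∕28); one finite four-torus programme at fixed `ε = L^{−K}` per run —
R4 closes the conditional rung `BalabanLadder.UV` only; NOT ℝ⁴ ∕ infinite volume ∕ OS; the Yang–Mills mass gap (Clay) is NOT proved by any of this.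
-/

noncomputable section

open scoped Matrix.Norms.L2Operator Topology ENNReal
open Filter Set Function MeasureTheory

namespace Summit.QuantumFields.YangMills.BalabanUVNodes.N09RegularOnOfLoopSmallChi29Local

open Literature.MathematicalPhysics.QuantumFieldTheory.Balaban1983to89
open Literature.MathematicalPhysics.QuantumFieldTheory.Balaban1983to89.BlockAveraging (Small loopHol)
open Literature.MathematicalPhysics.QuantumFieldTheory.Balaban1983to89.BlockAveragingHaarAC (centralBond)
open Literature.MathematicalPhysics.QuantumFieldTheory.Balaban1983to89.ExpMeanLog (expMeanLogSU deltaSU)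
open Literature.MathematicalPhysics.QuantumFieldTheory.Balaban1983to89.Node00
open Summit.QuantumFields.YangMills.BalabanUVNodes.N09ChartReadAveragingSmooth (continuousAt_avgFun_of_small)
open Summit.QuantumFields.YangMills.BalabanUVNodes.N09RegularOfLoopSmallChi29 (regular_of_loopSmall_chi29)

variable {F : T4Continuum.T4Family} {N : ℕ} [NeZero N] {K k : ℕ}

/-! ## §1 Fibre-locality of the transform of record and of its maximal regular set -/

/-- **FIBRE-LOCALITY OF THE TRANSFORM OF RECORD**: two integrable fine densities that agree on the fibres over a measurable set `U` of coarse fields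
(`ρ₁ = ρ₂` on `Ū⁻¹(U)`) have `dV`-a.e. EQUAL transforms of record on `U` (`k < K`).  Both `T(ρᵢ·𝟙_U∘Ū)` equal `𝟙_U·Tρᵢ` a.e. (this seat's g0
`Node00.transportOfRecord_mul_indicator_ae_eq`), and the two cut densities coincide. [cite: Balaban1988Convergent, (3.1) p.264; Balaban1985Averaging, (10) p.19 (bookkeeping)] -/
theorem transportOfRecord_ae_eq_on_of_eqOn_preimage (hk : k < K) {ρ₁ ρ₂ : Density (F.P K) k (SU N)}
    (h₁ : Integrable ρ₁ (fieldMeasure (F.P K) k (SU N))) (h₂ : Integrable ρ₂ (fieldMeasure (F.P K) k (SU N)))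
    {E : Set (GaugeField (F.P K) (k + 1) (SU N))} (hE : MeasurableSet E)
    (heq : ∀ W, (avOfRecord F N K k).avg W ∈ E → ρ₁ W = ρ₂ W) :
    transportOfRecord F N K k ρ₁ =ᵐ[(fieldMeasure (F.P K) (k + 1) (SU N)).restrict E] transportOfRecord F N K k ρ₂ := by
  have hcut : (fun W => ρ₁ W * E.indicator (fun _ => (1 : ℝ)) ((avOfRecord F N K k).avg W)) =
      fun W => ρ₂ W * E.indicator (fun _ => (1 : ℝ)) ((avOfRecord F N K k).avg W) := by
    funext W
    by_cases hW : (avOfRecord F N K k).avg W ∈ E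
    · rw [heq W hW]
    · rw [indicator_of_notMem hW, mul_zero, mul_zero]
  have e₁ := transportOfRecord_mul_indicator_ae_eq hk h₁ hE
  have e₂ := transportOfRecord_mul_indicator_ae_eq hk h₂ hE
  rw [hcut] at e₁
  have e : (fun V => transportOfRecord F N K k ρ₁ V * E.indicator (fun _ => (1 : ℝ)) V) =ᵐ[fieldMeasure (F.P K) (k + 1) (SU N)]
      fun V => transportOfRecord F N K k ρ₂ V * E.indicator (fun _ => (1 : ℝ)) V := e₁.symm.trans e₂
  filter_upwards [ae_restrict_of_ae (s := E) e, self_mem_ae_restrict hE] with V hV hVE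
  rwa [indicator_of_mem hVE, mul_one, mul_one] at hV

/-- … hence the on-domain β-version proviso on `U` is the SAME for the two densities. [cite: Balaban1987RG1, (0.13) p.254 and p.259 (bookkeeping)] -/
theorem hasContTransportOn_congr_of_eqOn_preimage (hk : k < K) {ρ₁ ρ₂ : Density (F.P K) k (SU N)}
    (h₁ : Integrable ρ₁ (fieldMeasure (F.P K) k (SU N))) (h₂ : Integrable ρ₂ (fieldMeasure (F.P K) k (SU N)))
    {U : Set (GaugeField (F.P K) (k + 1) (SU N))} (hU : MeasurableSet U)
    (heq : ∀ W, (avOfRecord F N K k).avg W ∈ U → ρ₁ W = ρ₂ W) :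
    HasContTransportOn F N K k ρ₁ U ↔ HasContTransportOn F N K k ρ₂ U :=
  hasContVersionOn_congr_ae (transportOfRecord_ae_eq_on_of_eqOn_preimage hk h₁ h₂ hU heq)

/-- … and, for OPEN `U`, the verdict `U ⊆ regSetOfRecord` transfers from one density to the other. [cite: Balaban1987RG1, (0.13) p.254 and p.259 (bookkeeping)] -/
theorem subset_regSetOfRecord_of_eqOn_preimage (hk : k < K) {ρ₁ ρ₂ : Density (F.P K) k (SU N)}
    (h₁ : Integrable ρ₁ (fieldMeasure (F.P K) k (SU N))) (h₂ : Integrable ρ₂ (fieldMeasure (F.P K) k (SU N)))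
    {U : Set (GaugeField (F.P K) (k + 1) (SU N))} (hU : IsOpen U)
    (heq : ∀ W, (avOfRecord F N K k).avg W ∈ U → ρ₁ W = ρ₂ W) (hreg : HasContTransportOn F N K k ρ₁ U) :
    U ⊆ regSetOfRecord F N K k ρ₂ :=
  haveI : BorelSpace (GaugeField (F.P K) (k + 1) (SU N)) := inferInstanceAs (BorelSpace (PBond (F.P K) (k + 1) → SU N))
  subset_regSetOfRecord_of_hasContTransportOn hU ((hasContTransportOn_congr_of_eqOn_preimage hk h₁ h₂ hU.measurableSet heq).1 hreg)

/-- **EVERY SUBSET OF THE MAXIMAL REGULAR SET CARRIES A CONTINUOUS VERSION OF THE TRANSFORM**: `s ⊆ regSetOfRecord K k ρ ⇒ HasContTransportOn K k ρ s`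
(K0e's countable gluing `hasContVersionOn_regSet` on the second-countable coarse Pi space with the open-positive product Haar measure, restricted to `s`).
[cite: Balaban1987RG1, (0.13) p.254 and p.259 (bookkeeping)] -/
theorem hasContTransportOn_of_subset_regSetOfRecord {ρ : Density (F.P K) k (SU N)} {s : Set (PBond (F.P K) (k + 1) → SU N)}
    (hs : s ⊆ regSetOfRecord F N K k ρ) : HasContTransportOn F N K k ρ s := by
  haveI := isOpenPosMeasure_piHaar_SUN N (F.P K) (k + 1)
  obtain ⟨g, hg, hae⟩ := (hasContVersionOn_regSet : HasContVersionOn (piHaar (F.P K) (k + 1) (SU N))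
    (fun V => transportOfRecord F N K k ρ V) (regSetOfRecord F N K k ρ))
  exact ⟨g, hg.mono hs, ae_restrict_of_ae_restrict_of_subset hs hae⟩

/-! ## §2 The coarse cut-off density `U ↦ 𝟙_{K₀}(U)·ρ(U)·φ(Ū U)` -/

section Cutoff

variable {ρ : Density (F.P K) k (SU N)} {K₀ : Set (GaugeField (F.P K) k (SU N))} {φ : GaugeField (F.P K) (k + 1) (SU N) → ℝ}

/-- The cut-off density is non-negative (`ρ ≥ 0`, `φ ≥ 0`). [cite: Balaban1987RG1, (0.13) p.254 (bookkeeping)] -/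
theorem cutoff_nonneg (hρ0 : ∀ U, 0 ≤ ρ U) (hφ0 : ∀ V, 0 ≤ φ V) (W : GaugeField (F.P K) k (SU N)) :
    0 ≤ K₀.indicator ρ W * φ ((avOfRecord F N K k).avg W) :=
  mul_nonneg (indicator_nonneg (fun U _ => hρ0 U) W) (hφ0 _)

/-- The cut-off density is bounded by `max C₀ 0` as soon as `ρ ≤ C₀` ON `K₀` (`ρ ≥ 0`, `0 ≤ φ ≤ 1`). [cite: Balaban1987RG1, (0.13) p.254 (bookkeeping)] -/
theorem cutoff_le (hρ0 : ∀ U, 0 ≤ ρ U) {C₀ : ℝ} (hρC : ∀ U ∈ K₀, ρ U ≤ C₀) (hφ1 : ∀ V, φ V ≤ 1)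
    (W : GaugeField (F.P K) k (SU N)) : K₀.indicator ρ W * φ ((avOfRecord F N K k).avg W) ≤ max C₀ 0 := by
  have h0 : 0 ≤ K₀.indicator ρ W := indicator_nonneg (fun U _ => hρ0 U) W
  refine (mul_le_of_le_one_right h0 (hφ1 _)).trans ?_
  by_cases hW : W ∈ K₀
  · rw [indicator_of_mem hW]; exact (hρC W hW).trans (le_max_left _ _)
  · rw [indicator_of_notMem hW]; exact le_max_right _ _

/-- The cut-off density vanishes off `K₀`. [cite: Balaban1987RG1, (0.13) p.254 (bookkeeping)] -/
theorem cutoff_eq_zero_of_not_mem {W : GaugeField (F.P K) k (SU N)} (hW : W ∉ K₀) :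
    K₀.indicator ρ W * φ ((avOfRecord F N K k).avg W) = 0 := by
  rw [indicator_of_notMem hW, zero_mul]

/-- The cut-off density is measurable (`K₀` closed, `ρ` measurable, `φ` continuous, the averaging of record measurable — K0e's `avOfRecord_measurable`).
[cite: Balaban1987RG1, (0.4) p.253 and (0.13) p.254 (bookkeeping)] -/
theorem measurable_cutoff (hρm : Measurable ρ) (hK₀ : IsClosed K₀) (hφc : Continuous φ) :
    Measurable fun W : GaugeField (F.P K) k (SU N) => K₀.indicator ρ W * φ ((avOfRecord F N K k).avg W) := by
  haveI : BorelSpace (GaugeField (F.P K) k (SU N)) := inferInstanceAs (BorelSpace (PBond (F.P K) k → SU N))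
  haveI : BorelSpace (GaugeField (F.P K) (k + 1) (SU N)) := inferInstanceAs (BorelSpace (PBond (F.P K) (k + 1) → SU N))
  exact (hρm.indicator hK₀.measurableSet).mul (hφc.measurable.comp (avOfRecord_measurable F N K k))

/-- ★★ **THE CUT-OFF DENSITY IS CONTINUOUS AT EVERY POINT OF `K₀` AT WHICH THE LOCAL DATA ALLOW IT.**  Data: `φ` continuous, `0 ≤ φ`, `φ = 0` off `D`;
`ρ ≥ 0`, `ρ ≤ C₀` on `K₀`; the LOCAL support clause `Ū W ∈ D → ρ W ≠ 0 → W ∈ interior K₀`; at the point `U ∈ K₀`: the averaging of record continuous at `U`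
and `ρ` continuous at `U` PROVIDED `Ū U ∈ D`.  Then `W ↦ 𝟙_{K₀}(W)·ρ(W)·φ(Ū W)` is continuous at `U` — cases `Ū U ∉ D` (value `0`, squeeze by `max C₀ 0·φ∘Ū`),
`Ū U ∈ D ∧ U ∈ interior K₀` (product), `Ū U ∈ D ∧ U ∉ interior K₀` (then `ρ U = 0`; squeeze by `ρ·φ∘Ū`). [cite: Balaban1987RG1, (0.4) p.253, (0.13) p.254 and p.259 (bookkeeping)] -/
theorem continuousAt_cutoff {D : Set (GaugeField (F.P K) (k + 1) (SU N))} (hφc : Continuous φ) (hφ0 : ∀ V, 0 ≤ φ V)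
    (hφD : ∀ V, V ∉ D → φ V = 0) (hρ0 : ∀ U, 0 ≤ ρ U) {C₀ : ℝ} (hρC : ∀ U ∈ K₀, ρ U ≤ C₀)
    (hρK : ∀ W, (avOfRecord F N K k).avg W ∈ D → ρ W ≠ 0 → W ∈ interior K₀)
    {U : GaugeField (F.P K) k (SU N)} (hU : U ∈ K₀) (havg : ContinuousAt (avOfRecord F N K k).avg U)
    (hρc : (avOfRecord F N K k).avg U ∈ D → ContinuousAt ρ U) :
    ContinuousAt (fun W : GaugeField (F.P K) k (SU N) => K₀.indicator ρ W * φ ((avOfRecord F N K k).avg W)) U := by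
  have hφU : ContinuousAt (fun W : GaugeField (F.P K) k (SU N) => φ ((avOfRecord F N K k).avg W)) U :=
    ContinuousAt.comp (f := (avOfRecord F N K k).avg) hφc.continuousAt havg
  have hc0 : ∀ W, 0 ≤ K₀.indicator ρ W * φ ((avOfRecord F N K k).avg W) := cutoff_nonneg hρ0 hφ0
  have hcρ : ∀ W : GaugeField (F.P K) k (SU N), K₀.indicator ρ W * φ ((avOfRecord F N K k).avg W) ≤ ρ W * φ ((avOfRecord F N K k).avg W) := by
    intro W
    refine mul_le_mul_of_nonneg_right ?_ (hφ0 _)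
    by_cases hW : W ∈ K₀
    · rw [indicator_of_mem hW]
    · rw [indicator_of_notMem hW]; exact hρ0 W
  have hcC : ∀ W : GaugeField (F.P K) k (SU N), K₀.indicator ρ W * φ ((avOfRecord F N K k).avg W) ≤ max C₀ 0 * φ ((avOfRecord F N K k).avg W) := by
    intro W
    refine mul_le_mul_of_nonneg_right ?_ (hφ0 _)
    by_cases hW : W ∈ K₀
    · rw [indicator_of_mem hW]; exact (hρC W hW).trans (le_max_left _ _)
    · rw [indicator_of_notMem hW]; exact le_max_right _ _
  by_cases hD : (avOfRecord F N K k).avg U ∈ D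
  · by_cases hint : U ∈ interior K₀
    · -- near `U` the indicator is `1`
      have hev : (fun W : GaugeField (F.P K) k (SU N) => K₀.indicator ρ W * φ ((avOfRecord F N K k).avg W)) =ᶠ[𝓝 U]
          fun W => ρ W * φ ((avOfRecord F N K k).avg W) := by
        filter_upwards [mem_interior_iff_mem_nhds.1 hint] with W hW
        rw [indicator_of_mem hW]
      have hprod : ContinuousAt (fun W : GaugeField (F.P K) k (SU N) => ρ W * φ ((avOfRecord F N K k).avg W)) U :=
        (hρc hD).mul hφU
      exact hprod.congr_of_eventuallyEq hev
    · -- `ρ U = 0`; squeeze between `0` and `ρ·φ∘Ū`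
      have hρU : ρ U = 0 := by
        by_contra h
        exact hint (hρK U hD h)
      have hlim : Tendsto (fun W : GaugeField (F.P K) k (SU N) => ρ W * φ ((avOfRecord F N K k).avg W)) (𝓝 U) (𝓝 0) := by
        have h : Tendsto (fun W : GaugeField (F.P K) k (SU N) => ρ W * φ ((avOfRecord F N K k).avg W)) (𝓝 U)
            (𝓝 (ρ U * φ ((avOfRecord F N K k).avg U))) := (hρc hD).tendsto.mul hφU.tendsto
        rwa [hρU, zero_mul] at h
      have hval : K₀.indicator ρ U * φ ((avOfRecord F N K k).avg U) = 0 := by rw [indicator_of_mem hU, hρU, zero_mul]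
      rw [ContinuousAt, hval]
      exact tendsto_of_tendsto_of_tendsto_of_le_of_le tendsto_const_nhds hlim hc0 hcρ
  · -- `φ (Ū U) = 0`; squeeze between `0` and `max C₀ 0 · φ∘Ū`
    have hφU0 : φ ((avOfRecord F N K k).avg U) = 0 := hφD _ hD
    have hlim : Tendsto (fun W : GaugeField (F.P K) k (SU N) => max C₀ 0 * φ ((avOfRecord F N K k).avg W)) (𝓝 U) (𝓝 0) := by
      have h : Tendsto (fun W : GaugeField (F.P K) k (SU N) => max C₀ 0 * φ ((avOfRecord F N K k).avg W)) (𝓝 U)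
          (𝓝 (max C₀ 0 * φ ((avOfRecord F N K k).avg U))) := tendsto_const_nhds.mul hφU.tendsto
      rwa [hφU0, mul_zero] at h
    have hval : K₀.indicator ρ U * φ ((avOfRecord F N K k).avg U) = 0 := by rw [hφU0, mul_zero]
    rw [ContinuousAt, hval]
    exact tendsto_of_tendsto_of_tendsto_of_le_of_le tendsto_const_nhds hlim hc0 hcC

end Cutoff

/-! ## §3 Road B localised over an open coarse set -/

/-- ★★★ **ROAD B LOCALISED OVER THE COARSE DOMAIN.**  For `k < K`, `ε₁ ≠ 0`, the loop α-guard in the standing range (`α ≤ 1∕24`, `α < δ_N`, `157·α < L^{1−d}`),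
`ν : Stage7Numerics` arbitrary, an OPEN set `D` of coarse fields, a CLOSED set `K₀` of fine fields inside the guard, and `ρ ≥ 0` measurable and integrable with
`ρ ≤ C₀` ON `K₀`, the LOCAL support clause `Ū U ∈ D → ρ U ≠ 0 → U ∈ interior K₀` and the LOCAL continuity clause
`∀ U ∈ K₀, Ū U ∈ D → (∀ b, (∀ c, β(c) ≠ b) → fluctDev_k(U)(b) ≠ ε₁) → ContinuousAt ρ U`:
`D ⊆ regSetOfRecord F N K k ρ` and `HasContTransportOn F N K k ρ D`.  Per `V₀ ∈ D`: a continuous bump `φ` (`= 1` on an open `U₁ ∋ V₀`, `= 0` off `D`; complete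
regularity of the coarse Pi space); g5's `regular_of_loopSmall_chi29` for the cut-off density `𝟙_{K₀}·ρ·φ∘Ū` (§2) gives `HasContTransportOn … U₁` for it; on
`Ū⁻¹(U₁)` the cut-off density IS `ρ`, so §1 transfers the proviso and `V₀ ∈ U₁ ⊆ regSetOfRecord K k ρ`.  The displayed clauses are asserted of NO record.
[cite: Balaban1987RG1, (0.13) p.254, p.259, (2.9) p.266 and (2.10) p.267] [cite: Balaban1985Averaging, (10) p.19 and (19) p.21] -/
theorem regularOn_of_loopSmall_chi29_local (ν : Stage7Numerics) (hk : k < K) {α : ℝ} (hα24 : α ≤ 1 / 24) (hαδ : α < deltaSU (Fin N))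
    (hαL : 157 * α < (((F.P K).L : ℝ) ^ ((F.P K).d - 1))⁻¹) {ε₁ : ℝ} (hε : ε₁ ≠ 0) {ρ : Density (F.P K) k (SU N)}
    (hρm : Measurable ρ) (hρi : Integrable ρ (fieldMeasure (F.P K) k (SU N))) (hρ0 : ∀ U, 0 ≤ ρ U)
    {D : Set (GaugeField (F.P K) (k + 1) (SU N))} (hD : IsOpen D)
    {K₀ : Set (GaugeField (F.P K) k (SU N))} (hK₀ : IsClosed K₀) (hK₀α : ∀ U ∈ K₀, ∀ c i, dist1 (loopHol U c i) ≤ α)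
    (hρC : ∃ C₀ : ℝ, ∀ U ∈ K₀, ρ U ≤ C₀)
    (hρK : ∀ U, (avOfRecord F N K k).avg U ∈ D → ρ U ≠ 0 → U ∈ interior K₀)
    (hρc : ∀ U ∈ K₀, (avOfRecord F N K k).avg U ∈ D →
      (∀ b : PBond (F.P K) k, (∀ c, centralBond c ≠ b) → fluctDevOfRecord F N ν K k U b ≠ ε₁) → ContinuousAt ρ U) :
    D ⊆ regSetOfRecord F N K k ρ ∧ HasContTransportOn F N K k ρ D := by
  classical
  obtain ⟨C₀, hC₀⟩ := hρC
  have hsmall : ∀ U ∈ K₀, ∀ c, Small (expMeanLogSU (n := Fin N)) U c := fun U hU c i => lt_of_le_of_lt (hK₀α U hU c i) hαδ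
  have hsub : D ⊆ regSetOfRecord F N K k ρ := by
    intro V₀ hV₀
    haveI : CompletelyRegularSpace (GaugeField (F.P K) (k + 1) (SU N)) :=
      inferInstanceAs (CompletelyRegularSpace (PBond (F.P K) (k + 1) → SU N))
    haveI : BorelSpace (GaugeField (F.P K) (k + 1) (SU N)) := inferInstanceAs (BorelSpace (PBond (F.P K) (k + 1) → SU N))
    -- a continuous bump at `V₀` inside `D`
    obtain ⟨f, hfc, hf0, hf1⟩ := CompletelyRegularSpace.completely_regular (V₀ : GaugeField (F.P K) (k + 1) (SU N)) Dᶜ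
      hD.isClosed_compl (fun h => h hV₀)
    have hfc' : Continuous fun V : GaugeField (F.P K) (k + 1) (SU N) => (f V : ℝ) := continuous_subtype_val.comp hfc
    set φ : GaugeField (F.P K) (k + 1) (SU N) → ℝ := fun V => min 1 (max 0 (2 - 3 * (f V : ℝ))) with hφ
    have hφc : Continuous φ := continuous_const.min (continuous_const.max (continuous_const.sub (continuous_const.mul hfc')))
    have hφ0 : ∀ V, 0 ≤ φ V := fun V => le_min zero_le_one (le_max_left _ _)
    have hφ1 : ∀ V, φ V ≤ 1 := fun V => min_le_left _ _
    have hφD : ∀ V, V ∉ D → φ V = 0 := by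
      intro V hV
      have h1 : (f V : ℝ) = 1 := by rw [show f V = 1 from hf1 hV]; exact Set.Icc.coe_one
      show min 1 (max 0 (2 - 3 * (f V : ℝ))) = 0
      rw [h1, show (2 : ℝ) - 3 * 1 = -1 by norm_num, max_eq_left (by norm_num : (-1 : ℝ) ≤ 0)]
      exact min_eq_right zero_le_one
    -- the open set on which `φ = 1`
    set U₁ : Set (GaugeField (F.P K) (k + 1) (SU N)) := {V | (f V : ℝ) < 1 / 3} with hU₁
    have hU₁o : IsOpen U₁ := isOpen_lt hfc' continuous_const
    have hV₀U₁ : V₀ ∈ U₁ := by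
      show (f V₀ : ℝ) < 1 / 3
      rw [hf0, Set.Icc.coe_zero]; norm_num
    have hφU₁ : ∀ V ∈ U₁, φ V = 1 := by
      intro V hV
      have hV' : (f V : ℝ) < 1 / 3 := hV
      show min 1 (max 0 (2 - 3 * (f V : ℝ))) = 1
      exact min_eq_left (le_max_of_le_right (by linarith))
    have hU₁D : U₁ ⊆ D := by
      intro V hV
      by_contra hVD
      have h := hφD V hVD
      rw [hφU₁ V hV] at h
      exact one_ne_zero h
    -- the cut-off density meets g5's GLOBAL hypotheses
    have hcm := measurable_cutoff (ρ := ρ) (φ := φ) hρm hK₀ hφc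
    have hc0 : ∀ W, 0 ≤ K₀.indicator ρ W * φ ((avOfRecord F N K k).avg W) := cutoff_nonneg hρ0 hφ0
    have hcC : ∃ C : ℝ, ∀ W, K₀.indicator ρ W * φ ((avOfRecord F N K k).avg W) ≤ C := ⟨max C₀ 0, cutoff_le hρ0 hC₀ hφ1⟩
    have hcK : ∀ W, W ∉ K₀ → K₀.indicator ρ W * φ ((avOfRecord F N K k).avg W) = 0 := fun W hW => cutoff_eq_zero_of_not_mem hW
    have hcc : ∀ W ∈ K₀, (∀ b : PBond (F.P K) k, (∀ c, centralBond c ≠ b) → fluctDevOfRecord F N ν K k W b ≠ ε₁) →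
        ContinuousAt (fun W : GaugeField (F.P K) k (SU N) => K₀.indicator ρ W * φ ((avOfRecord F N K k).avg W)) W :=
      fun W hW hQ => continuousAt_cutoff hφc hφ0 hφD hρ0 hC₀ hρK hW
        (continuousAt_avgFun_of_small (P := F.P K) (j := k) W (hsmall W hW)) (fun hWD => hρc W hW hWD hQ)
    have hreg := (regular_of_loopSmall_chi29 ν hk hα24 hαδ hαL hε hcm hc0 hcC hK₀ hcK hK₀α hcc).1 U₁ hU₁o
    -- on `Ū⁻¹(U₁)` the cut-off density IS `ρ`
    have heqOn : ∀ W, (avOfRecord F N K k).avg W ∈ U₁ → K₀.indicator ρ W * φ ((avOfRecord F N K k).avg W) = ρ W := by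
      intro W hW
      rw [hφU₁ _ hW, mul_one]
      by_cases hWK : W ∈ K₀
      · rw [indicator_of_mem hWK]
      · rw [indicator_of_notMem hWK]
        by_contra hne
        exact hWK (interior_subset (hρK W (hU₁D hW) (Ne.symm hne)))
    have hci : Integrable (fun W : GaugeField (F.P K) k (SU N) => K₀.indicator ρ W * φ ((avOfRecord F N K k).avg W))
        (fieldMeasure (F.P K) k (SU N)) :=
      Integrable.of_bound hcm.aestronglyMeasurable (max C₀ 0)
        (Eventually.of_forall fun W => by rw [Real.norm_eq_abs, abs_of_nonneg (hc0 W)]; exact cutoff_le hρ0 hC₀ hφ1 W)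
    exact subset_regSetOfRecord_of_eqOn_preimage hk hci hρi hU₁o heqOn hreg.2 hV₀U₁
  exact ⟨hsub, hasContTransportOn_of_subset_regSetOfRecord hsub⟩

/-- **… so `TcanOfRecord F N K k ρ` is continuous on `D`** (K0e's `continuousOn_TcanOfRecord` on the maximal regular set, restricted).
[cite: Balaban1987RG1, (0.13) p.254 and p.259] -/
theorem continuousOn_TcanOfRecord_of_loopSmall_chi29_local (ν : Stage7Numerics) (hk : k < K) {α : ℝ} (hα24 : α ≤ 1 / 24) (hαδ : α < deltaSU (Fin N))
    (hαL : 157 * α < (((F.P K).L : ℝ) ^ ((F.P K).d - 1))⁻¹) {ε₁ : ℝ} (hε : ε₁ ≠ 0) {ρ : Density (F.P K) k (SU N)}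
    (hρm : Measurable ρ) (hρi : Integrable ρ (fieldMeasure (F.P K) k (SU N))) (hρ0 : ∀ U, 0 ≤ ρ U)
    {D : Set (GaugeField (F.P K) (k + 1) (SU N))} (hD : IsOpen D)
    {K₀ : Set (GaugeField (F.P K) k (SU N))} (hK₀ : IsClosed K₀) (hK₀α : ∀ U ∈ K₀, ∀ c i, dist1 (loopHol U c i) ≤ α)
    (hρC : ∃ C₀ : ℝ, ∀ U ∈ K₀, ρ U ≤ C₀)
    (hρK : ∀ U, (avOfRecord F N K k).avg U ∈ D → ρ U ≠ 0 → U ∈ interior K₀)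
    (hρc : ∀ U ∈ K₀, (avOfRecord F N K k).avg U ∈ D →
      (∀ b : PBond (F.P K) k, (∀ c, centralBond c ≠ b) → fluctDevOfRecord F N ν K k U b ≠ ε₁) → ContinuousAt ρ U) :
    ContinuousOn (fun V : PBond (F.P K) (k + 1) → SU N => TcanOfRecord F N K k ρ V) D :=
  (continuousOn_TcanOfRecord K k ρ).mono (regularOn_of_loopSmall_chi29_local ν hk hα24 hαδ hαL hε hρm hρi hρ0 hD hK₀ hK₀α hρC hρK hρc).1

/-- ★ **THE `hreg` SHAPE FROM LOCAL DATA**: `domAltOfRecord F N ν' K (k+1) ⊆ regSetOfRecord F N K k ρ` — the binder of the N09 small-field-bookkeeping doors — for every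
`ρ` as in `regularOn_of_loopSmall_chi29_local` with `D := domAltOfRecord ν' K (k+1)` (open, `isOpen_domAltOfRecord`): the support, boundedness and continuity
clauses are asked only over the fibres over the next small-field domain. [cite: Balaban1987RG1, p.259, (2.9) p.266 and (2.10) p.267] -/
theorem domAlt_subset_regSetOfRecord_of_loopSmall_chi29_local (ν ν' : Stage7Numerics) (hk : k < K) {α : ℝ} (hα24 : α ≤ 1 / 24)
    (hαδ : α < deltaSU (Fin N)) (hαL : 157 * α < (((F.P K).L : ℝ) ^ ((F.P K).d - 1))⁻¹) {ε₁ : ℝ} (hε : ε₁ ≠ 0)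
    {ρ : Density (F.P K) k (SU N)} (hρm : Measurable ρ) (hρi : Integrable ρ (fieldMeasure (F.P K) k (SU N))) (hρ0 : ∀ U, 0 ≤ ρ U)
    {K₀ : Set (GaugeField (F.P K) k (SU N))} (hK₀ : IsClosed K₀) (hK₀α : ∀ U ∈ K₀, ∀ c i, dist1 (loopHol U c i) ≤ α)
    (hρC : ∃ C₀ : ℝ, ∀ U ∈ K₀, ρ U ≤ C₀)
    (hρK : ∀ U, (avOfRecord F N K k).avg U ∈ domAltOfRecord F N ν' K (k + 1) → ρ U ≠ 0 → U ∈ interior K₀)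
    (hρc : ∀ U ∈ K₀, (avOfRecord F N K k).avg U ∈ domAltOfRecord F N ν' K (k + 1) →
      (∀ b : PBond (F.P K) k, (∀ c, centralBond c ≠ b) → fluctDevOfRecord F N ν K k U b ≠ ε₁) → ContinuousAt ρ U) :
    domAltOfRecord F N ν' K (k + 1) ⊆ regSetOfRecord F N K k ρ ∧ HasContTransportOn F N K k ρ (domAltOfRecord F N ν' K (k + 1)) :=
  regularOn_of_loopSmall_chi29_local ν hk hα24 hαδ hαL hε hρm hρi hρ0 (B12ContinuousTransportInvarianceOn.isOpen_domAltOfRecord ν' K (k + 1))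
    hK₀ hK₀α hρC hρK hρc

end Summit.QuantumFields.YangMills.BalabanUVNodes.N09RegularOnOfLoopSmallChi29Local

end
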